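import Mathlib
import Summits.Ventures.PercRepro2.Tail2DBlockCalc
import Summits.Ventures.PercRepro2.Tail2DHarrisSP
import Summits.Ventures.PercRepro2.Tail2DFlowOneBlocks
import Summits.Ventures.PercRepro2.Tail2DFlowOneStep01
import Summits.Ventures.PercRepro2.Tail2DParFin
import Summits.Ventures.PercRepro2.Tail2DParFinFlip
import Summits.Ventures.PercRepro2.Tail2DParFinTop
import Summits.Ventures.PercRepro2.Tail2DParFinDiag
import Summits.Ventures.PercRepro2.Tail2DParFinCount
import Summits.Ventures.PercRepro2.Tail2DParFinRelax
import Summits.Ventures.PercRepro2.Tail2DParFinSubTop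
import Summits.Ventures.PercRepro2.Tail2DParFinSubTopB
import Summits.Ventures.PercRepro2.Tail2DParFinFibres
import Summits.Ventures.PercRepro2.Tail2DOneChange
import Summits.Ventures.PercRepro2.Tail2DOneChangeB
import Summits.Ventures.PercRepro2.Tail2DOneChangeC
import Summits.Ventures.PercRepro2.Tail2DFourIdent

/-!
# (SD) at `(3,0)` on `7` identical flow-one factors — an explicit one-change table
(seat mine-b, cell pub-perc-repro2; conjectures/MINE-B.md §44)

The rates are `P(c/a)/D(c/a)` with `P` of non-negative coefficients (found by an LP on the coefficients, verified
exactly; mining/mine-b/code/g42/k67_tables.json, k78_tables.json), applied through the generic theorem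
`sdomZ_of_oneChange`; the per-type identities are in the companion files `Tail2DSevIdent30S*`, `Tail2DSevIdent30T*`, `Tail2DSevIdent30Z`.
-/

namespace Summit.Ventures.PercRepro2.Tail2D

open V2Closure Finset

namespace IdentSev30

/-- `D = 119 * a ^ 4 + 392 * a ^ 3 * c + 525 * a ^ 2 * c ^ 2 + 350 * a * c ^ 3 + 105 * c ^ 4` at `(3,0)` on `7` identical factors -/
noncomputable def dN (Y : V2Closure.SP) : ℚ := 119 * aY Y ^ 4 + 392 * aY Y ^ 3 * cY Y + 525 * aY Y ^ 2 * cY Y ^ 2 + 350 * aY Y * cY Y ^ 3 + 105 * cY Y ^ 4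

/-- the identity rate by the type `(#R, #B)` -/
noncomputable def ιN (Y : V2Closure.SP) (r b : ℕ) : ℚ :=
  if r = 3 ∧ b = 1 then ((298 / 5 : ℚ) * aY Y ^ 5 + (1711 / 10 : ℚ) * aY Y ^ 4 * cY Y + (819 / 4 : ℚ) * aY Y ^ 3 * cY Y ^ 2 + (287 / 4 : ℚ) * aY Y ^ 2 * cY Y ^ 3 + (35 / 4 : ℚ) * aY Y * cY Y ^ 4) / (aY Y * dN Y) else
  if r = 4 ∧ b = 1 then ((284 / 5 : ℚ) * aY Y ^ 5 + (490 / 3 : ℚ) * aY Y ^ 4 * cY Y + (518 / 3 : ℚ) * aY Y ^ 3 * cY Y ^ 2 + 70 * aY Y ^ 2 * cY Y ^ 3 + 14 * aY Y * cY Y ^ 4) / (aY Y * dN Y) else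
  if r = 5 ∧ b = 1 then (73 * aY Y ^ 5 + (1255 / 6 : ℚ) * aY Y ^ 4 * cY Y + (497 / 2 : ℚ) * aY Y ^ 3 * cY Y ^ 2 + (350 / 3 : ℚ) * aY Y ^ 2 * cY Y ^ 3 + (35 / 2 : ℚ) * aY Y * cY Y ^ 4) / (aY Y * dN Y) else
  if r = 6 ∧ b = 1 then (82 * aY Y ^ 5 + 238 * aY Y ^ 4 * cY Y + 261 * aY Y ^ 3 * cY Y ^ 2 + 125 * aY Y ^ 2 * cY Y ^ 3 + 20 * aY Y * cY Y ^ 4) / (aY Y * dN Y) else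
  if r = 3 ∧ b = 2 then ((298 / 5 : ℚ) * aY Y ^ 5 + (781 / 5 : ℚ) * aY Y ^ 4 * cY Y + (1229 / 15 : ℚ) * aY Y ^ 3 * cY Y ^ 2 + (70 / 3 : ℚ) * aY Y ^ 2 * cY Y ^ 3) / (aY Y * dN Y) else
  if r = 4 ∧ b = 2 then ((1112 / 15 : ℚ) * aY Y ^ 5 + (1188 / 5 : ℚ) * aY Y ^ 4 * cY Y + (1381 / 5 : ℚ) * aY Y ^ 3 * cY Y ^ 2 + (361 / 3 : ℚ) * aY Y ^ 2 * cY Y ^ 3 + 35 * aY Y * cY Y ^ 4) / (aY Y * dN Y) else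
  if r = 5 ∧ b = 2 then ((260 / 3 : ℚ) * aY Y ^ 5 + 255 * aY Y ^ 4 * cY Y + 287 * aY Y ^ 3 * cY Y ^ 2 + 100 * aY Y ^ 2 * cY Y ^ 3 + (20 / 3 : ℚ) * aY Y * cY Y ^ 4) / (aY Y * dN Y) else
  if r = 3 ∧ b = 3 then ((298 / 5 : ℚ) * aY Y ^ 5 + (781 / 5 : ℚ) * aY Y ^ 4 * cY Y + 147 * aY Y ^ 3 * cY Y ^ 2 + (543 / 4 : ℚ) * aY Y ^ 2 * cY Y ^ 3) / (aY Y * dN Y) else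
  if r = 4 ∧ b = 3 then ((398 / 5 : ℚ) * aY Y ^ 5 + (1156 / 5 : ℚ) * aY Y ^ 4 * cY Y + (991 / 5 : ℚ) * aY Y ^ 3 * cY Y ^ 2 + (147 / 5 : ℚ) * aY Y ^ 2 * cY Y ^ 3 + 35 * aY Y * cY Y ^ 4) / (aY Y * dN Y) else
  if r = 3 ∧ b = 4 then ((298 / 5 : ℚ) * aY Y ^ 5 + (781 / 5 : ℚ) * aY Y ^ 4 * cY Y + 147 * aY Y ^ 3 * cY Y ^ 2 + (217 / 5 : ℚ) * aY Y ^ 2 * cY Y ^ 3) / (aY Y * dN Y) else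
  0

/-- the flip rate per red by the type -/
noncomputable def fN (Y : V2Closure.SP) (r b : ℕ) : ℚ :=
  if b = 0 then ((r : ℚ))⁻¹ else
  if r = 3 ∧ b = 1 then ((149 / 30 : ℚ) * aY Y ^ 5 + (539 / 30 : ℚ) * aY Y ^ 4 * cY Y + (77 / 3 : ℚ) * aY Y ^ 3 * cY Y ^ 2 + (455 / 12 : ℚ) * aY Y ^ 2 * cY Y ^ 3 + (35 / 2 : ℚ) * aY Y * cY Y ^ 4) / (aY Y * dN Y) else
  if r = 4 ∧ b = 1 then ((37 / 3 : ℚ) * aY Y ^ 5 + (913 / 20 : ℚ) * aY Y ^ 4 * cY Y + (4787 / 60 : ℚ) * aY Y ^ 3 * cY Y ^ 2 + (259 / 4 : ℚ) * aY Y ^ 2 * cY Y ^ 3 + (35 / 2 : ℚ) * aY Y * cY Y ^ 4) / (aY Y * dN Y) else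
  if r = 5 ∧ b = 1 then ((37 / 30 : ℚ) * aY Y ^ 4 * cY Y) / (aY Y * dN Y) else
  if r = 6 ∧ b = 1 then ((49 / 2 : ℚ) * aY Y ^ 3 * cY Y ^ 2 + (75 / 2 : ℚ) * aY Y ^ 2 * cY Y ^ 3 + (85 / 6 : ℚ) * aY Y * cY Y ^ 4) / (aY Y * dN Y) else
  if r = 3 ∧ b = 2 then ((125 / 6 : ℚ) * aY Y ^ 3 * cY Y ^ 2 + (35 / 2 : ℚ) * aY Y ^ 2 * cY Y ^ 3 + (35 / 3 : ℚ) * aY Y * cY Y ^ 4) / (aY Y * dN Y) else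
  if r = 4 ∧ b = 2 then ((106 / 15 : ℚ) * aY Y ^ 5 + (39 / 2 : ℚ) * aY Y ^ 4 * cY Y + (13 / 3 : ℚ) * aY Y ^ 2 * cY Y ^ 3 + (35 / 3 : ℚ) * aY Y * cY Y ^ 4) / (aY Y * dN Y) else
  if r = 5 ∧ b = 2 then ((289 / 15 : ℚ) * aY Y ^ 4 * cY Y + (667 / 15 : ℚ) * aY Y ^ 3 * cY Y ^ 2 + (433 / 15 : ℚ) * aY Y ^ 2 * cY Y ^ 3) / (aY Y * dN Y) else
  if r = 3 ∧ b = 3 then ((488 / 15 : ℚ) * aY Y ^ 3 * cY Y ^ 2 + (21 / 2 : ℚ) * aY Y ^ 2 * cY Y ^ 3 + (35 / 4 : ℚ) * aY Y * cY Y ^ 4) / (aY Y * dN Y) else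
  if r = 4 ∧ b = 3 then ((41 / 10 : ℚ) * aY Y ^ 5 + (483 / 20 : ℚ) * aY Y ^ 2 * cY Y ^ 3 + (35 / 4 : ℚ) * aY Y * cY Y ^ 4) / (aY Y * dN Y) else
  if r = 3 ∧ b = 4 then (7 * aY Y ^ 2 * cY Y ^ 3 + 7 * aY Y * cY Y ^ 4) / (aY Y * dN Y) else
  0

/-- the relax rate per red by the type -/
noncomputable def xN (Y : V2Closure.SP) (r b : ℕ) : ℚ :=
  if r = 3 ∧ b = 1 then ((89 / 6 : ℚ) * aY Y ^ 5 + (245 / 6 : ℚ) * aY Y ^ 4 * cY Y + (161 / 4 : ℚ) * aY Y ^ 3 * cY Y ^ 2 + (175 / 12 : ℚ) * aY Y ^ 2 * cY Y ^ 3) / (aY Y * dN Y) else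
  if r = 4 ∧ b = 1 then ((193 / 60 : ℚ) * aY Y ^ 5 + (83 / 10 : ℚ) * aY Y ^ 4 * cY Y + (21 / 4 : ℚ) * aY Y ^ 2 * cY Y ^ 3) / (aY Y * dN Y) else
  if r = 5 ∧ b = 1 then ((46 / 5 : ℚ) * aY Y ^ 5 + (392 / 15 : ℚ) * aY Y ^ 4 * cY Y + (175 / 6 : ℚ) * aY Y ^ 3 * cY Y ^ 2 + (35 / 2 : ℚ) * aY Y ^ 2 * cY Y ^ 3) / (aY Y * dN Y) else
  if r = 6 ∧ b = 1 then ((37 / 6 : ℚ) * aY Y ^ 5 + (39 / 2 : ℚ) * aY Y ^ 4 * cY Y) / (aY Y * dN Y) else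
  if r = 3 ∧ b = 2 then ((99 / 5 : ℚ) * aY Y ^ 5 + (294 / 5 : ℚ) * aY Y ^ 4 * cY Y + (1225 / 18 : ℚ) * aY Y ^ 3 * cY Y ^ 2 + (70 / 3 : ℚ) * aY Y ^ 2 * cY Y ^ 3) / (aY Y * dN Y) else
  if r = 4 ∧ b = 2 then ((83 / 20 : ℚ) * aY Y ^ 5 + (299 / 20 : ℚ) * aY Y ^ 4 * cY Y + (189 / 4 : ℚ) * aY Y ^ 3 * cY Y ^ 2 + (35 / 6 : ℚ) * aY Y ^ 2 * cY Y ^ 3) / (aY Y * dN Y) else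
  if r = 5 ∧ b = 2 then ((97 / 15 : ℚ) * aY Y ^ 5 + (5 / 3 : ℚ) * aY Y ^ 4 * cY Y + (22 / 15 : ℚ) * aY Y ^ 3 * cY Y ^ 2 + (59 / 3 : ℚ) * aY Y ^ 2 * cY Y ^ 3) / (aY Y * dN Y) else
  if r = 3 ∧ b = 3 then ((99 / 5 : ℚ) * aY Y ^ 5 + (294 / 5 : ℚ) * aY Y ^ 4 * cY Y + (104 / 3 : ℚ) * aY Y ^ 3 * cY Y ^ 2 + (105 / 4 : ℚ) * aY Y ^ 2 * cY Y ^ 3) / (aY Y * dN Y) else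
  if r = 4 ∧ b = 3 then ((23 / 4 : ℚ) * aY Y ^ 5 + (689 / 20 : ℚ) * aY Y ^ 4 * cY Y + (189 / 4 : ℚ) * aY Y ^ 3 * cY Y ^ 2 + (35 / 4 : ℚ) * aY Y ^ 2 * cY Y ^ 3) / (aY Y * dN Y) else
  if r = 3 ∧ b = 4 then ((99 / 5 : ℚ) * aY Y ^ 5 + (294 / 5 : ℚ) * aY Y ^ 4 * cY Y + (336 / 5 : ℚ) * aY Y ^ 3 * cY Y ^ 2 + 28 * aY Y ^ 2 * cY Y ^ 3) / (aY Y * dN Y) else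
  0

/-- the rate table -/
noncomputable def ratesN (Y : V2Closure.SP) : OCRates 7 where
  ι := fun w => ιN Y (nR 7 w) (nB 7 w)
  f := fun w _ => fN Y (nR 7 w) (nB 7 w)
  x := fun w _ => xN Y (nR 7 w) (nB 7 w)

variable {Y : V2Closure.SP}

/-- `D > 0` -/
theorem dN_pos (hR : 0 < (rSet Y).card) : 0 < dN Y := by
  unfold dN aY cY
  have : (0 : ℚ) < (rSet Y).card := by exact_mod_cast hR
  positivity

/-- non-negativity of the rates -/
theorem ιN_nonneg (hR : 0 < (rSet Y).card) (r b : ℕ) : 0 ≤ ιN Y r b := by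
  have := dN_pos hR
  have ha : (0 : ℚ) < aY Y := by unfold aY; exact_mod_cast hR
  have hc : (0 : ℚ) ≤ cY Y := by unfold cY; positivity
  unfold ιN
  positivity

/-- non-negativity of the rates -/
theorem ratesN_iota_nonneg (hR : 0 < (rSet Y).card) (w : Fin 7 → Ltr) : 0 ≤ (ratesN Y).ι w :=
  ιN_nonneg hR _ _

/-- non-negativity of the rates -/
theorem fN_nonneg (hR : 0 < (rSet Y).card) (r b : ℕ) : 0 ≤ fN Y r b := by
  have := dN_pos hR
  have ha : (0 : ℚ) < aY Y := by unfold aY; exact_mod_cast hR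
  have hc : (0 : ℚ) ≤ cY Y := by unfold cY; positivity
  unfold fN
  positivity

/-- non-negativity of the rates -/
theorem ratesN_f_nonneg (hR : 0 < (rSet Y).card) (w : Fin 7 → Ltr) (i : Fin 7) : 0 ≤ (ratesN Y).f w i :=
  fN_nonneg hR _ _

/-- non-negativity of the rates -/
theorem xN_nonneg (hR : 0 < (rSet Y).card) (r b : ℕ) : 0 ≤ xN Y r b := by
  have := dN_pos hR
  have ha : (0 : ℚ) < aY Y := by unfold aY; exact_mod_cast hR
  have hc : (0 : ℚ) ≤ cY Y := by unfold cY; positivity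
  unfold xN
  positivity

/-- non-negativity of the rates -/
theorem ratesN_x_nonneg (hR : 0 < (rSet Y).card) (w : Fin 7 → Ltr) (i : Fin 7) : 0 ≤ (ratesN Y).x w i :=
  xN_nonneg hR _ _

/-- `|E(3,0)|` -/
theorem tailCountN_src (hY : FlowOne Y) : (tailCount (parFin 7 (fun _ => Y)) 3 0 : ℚ) = aY Y ^ 3 * (99 * aY Y ^ 4 + 294 * aY Y ^ 3 * cY Y + 336 * aY Y ^ 2 * cY Y ^ 2 + 175 * aY Y * cY Y ^ 3 + 35 * cY Y ^ 4) := by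
  rw [tailCount_parFin_ident 7 Y hY 3 0]
  unfold aY cY
  simp only [Finset.sum_range_succ, Finset.sum_range_zero]
  norm_num [Nat.choose]
  ring

/-- `|E(2,1)|` -/
theorem tailCountN_tgt (hY : FlowOne Y) : (tailCount (parFin 7 (fun _ => Y)) 2 1 : ℚ) = aY Y ^ 3 * dN Y := by
  rw [tailCount_parFin_ident 7 Y hY 2 1]
  unfold dN aY cY
  simp only [Finset.sum_range_succ, Finset.sum_range_zero]
  norm_num [Nat.choose]
  ring

/-- `γ_i = c/a` -/
theorem gamN (i : Fin 7) : gam 7 (fun _ => Y) i = cY Y / aY Y := rfl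


/-- the target sums by the type of the word -/
theorem tgt_reduce (w0 : Fin 7 → Ltr) :
    (if ocCom 7 3 0 w0 then (ratesN Y).ι w0 else 0)
      + ∑ j ∈ blueSet 7 w0, ((ratesN Y).f (Function.update w0 j Ltr.R) j
          + (if ocCom 7 3 0 (Function.update w0 j Ltr.R) then (ratesN Y).x (Function.update w0 j Ltr.R) j else 0))
      + ∑ l ∈ cSet 7 w0, (ratesN Y).x (Function.update w0 l Ltr.R) l
    = (if (3 ≤ nR 7 w0 ∧ 0 ≤ nB 7 w0) ∧ 0 + 1 ≤ nB 7 w0 then ιN Y (nR 7 w0) (nB 7 w0) else 0)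
      + (nB 7 w0 : ℚ) * (fN Y (nR 7 w0 + 1) (nB 7 w0 - 1)
          + (if (3 ≤ nR 7 w0 + 1 ∧ 0 ≤ nB 7 w0 - 1) ∧ 0 + 1 ≤ nB 7 w0 - 1
            then xN Y (nR 7 w0 + 1) (nB 7 w0 - 1) else 0))
      + (nC 7 w0 : ℚ) * xN Y (nR 7 w0 + 1) (nB 7 w0) := by
  have hι : ∀ w', (ratesN Y).ι w' = ιN Y (nR 7 w') (nB 7 w') := fun _ => rfl
  have hf : ∀ w' i, (ratesN Y).f w' i = fN Y (nR 7 w') (nB 7 w') := fun _ _ => rfl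
  have hx : ∀ w' i, (ratesN Y).x w' i = xN Y (nR 7 w') (nB 7 w') := fun _ _ => rfl
  simp only [hι, hf, hx]
  have hsumB : ∑ j ∈ blueSet 7 w0, (fN Y (nR 7 (Function.update w0 j Ltr.R)) (nB 7 (Function.update w0 j Ltr.R))
      + (if ocCom 7 3 0 (Function.update w0 j Ltr.R)
          then xN Y (nR 7 (Function.update w0 j Ltr.R)) (nB 7 (Function.update w0 j Ltr.R)) else 0))
      = (nB 7 w0 : ℚ) * (fN Y (nR 7 w0 + 1) (nB 7 w0 - 1)
          + (if (3 ≤ nR 7 w0 + 1 ∧ 0 ≤ nB 7 w0 - 1) ∧ 0 + 1 ≤ nB 7 w0 - 1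
            then xN Y (nR 7 w0 + 1) (nB 7 w0 - 1) else 0)) := by
    rw [nB_eq_card_blueSet, ← nsmul_eq_mul, ← Finset.sum_const]
    apply Finset.sum_congr rfl
    intro j hj
    have hjB : w0 j = Ltr.B := by simpa [blueSet] using hj
    have e1 := nR_update_R 7 w0 j (by rw [hjB]; exact Ltr.noConfusion)
    have e2 := nB_update_R_of_B 7 w0 j hjB
    have e2' : nB 7 (Function.update w0 j Ltr.R) = nB 7 w0 - 1 := by omega
    have hcom : ocCom 7 3 0 (Function.update w0 j Ltr.R)
        ↔ (3 ≤ nR 7 (Function.update w0 j Ltr.R) ∧ 0 ≤ nB 7 (Function.update w0 j Ltr.R))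
          ∧ 0 + 1 ≤ nB 7 (Function.update w0 j Ltr.R) := Iff.rfl
    simp only [hcom, e1, e2']
    rw [nB_eq_card_blueSet]
  have hsumC : ∑ l ∈ cSet 7 w0, xN Y (nR 7 (Function.update w0 l Ltr.R)) (nB 7 (Function.update w0 l Ltr.R))
      = (nC 7 w0 : ℚ) * xN Y (nR 7 w0 + 1) (nB 7 w0) := by
    show _ = ((cSet 7 w0).card : ℚ) * _
    rw [← nsmul_eq_mul, ← Finset.sum_const]
    apply Finset.sum_congr rfl
    intro l hl
    have hlC : w0 l = Ltr.C := by simpa [cSet] using hl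
    have e1 := nR_update_R 7 w0 l (by rw [hlC]; exact Ltr.noConfusion)
    have e2 := nB_update_R_of_ne 7 w0 l (by rw [hlC]; exact Ltr.noConfusion)
    rw [e1, e2]
  rw [hsumB, hsumC]


end IdentSev30

end Summit.Ventures.PercRepro2.Tail2D
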